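import Literature.Geometry.DiscreteGeometry.TwoShellPatterns
import Summits.AtomisticToContinuum.Crystallization.Theorems.ChargedEnergyGap.Negative.Periodisation
import Summits.AtomisticToContinuum.Crystallization.Theorems.LayeredLawsSelectHcp.Negative.Threshold

/-!
# Route `PhononSlackCertificates`, item `AllBadGap` (stmt-AtomisticToContinuum-13960): the unconditional part

`AllBadGap` (route decl `Summit.AtomisticToContinuum.Crystallization.Theses.PhononSlackCertificates.AllBadGap`):
for every `δ > 0` there is `g > 0` such that every `δ`-separated configuration `x : Fin N → ℝ³` in
which EVERY particle is `1/20`-bad (`¬ IsTwoShellGood (1/20) (47/50) 1 x i`) has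
`N · (e* + g) ≤ 𝓔_LJ(x)`, `e* = ⨅_Q e(Q)` over periodic configurations.

This file (no route import: it speaks the Literature vocabulary of the decl only) lands what is
provable unconditionally:

* `card_mul_iInf_le_interactionEnergy`, `allBadGap_zero` — the `g = 0` FLOOR `N · e* ≤ 𝓔_LJ(x)`
  for every injective / `δ`-separated `x` (periodisation with a large cubic period plus the
  proved boundedness below of periodic energies, item 0714 — both in tree).
* `allBadGap_dilute`, `allBadGap_of_two_le` — the DILUTE REGIME `δ ≥ 2`: the conclusion holds with
  the explicit `g = 1/2 − (250/12)·δ⁻⁶ > 0` and WITHOUT the badness hypothesis (shell sum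
  `sum_inv_pow_six_le` for the attractive part, certified `e* ≤ e(fcc, 1) ≤ −1/2`);
  `allBadGap_of_two_le` has the exact shape of the decl with `0 < δ` replaced by `2 ≤ δ`.

The companion file `PhononSlackCertificatesAllBadGap.lean` derives the decl from the route's cruxes
(`CoerciveTwoShellGap → AllBadGap`, `FarFieldGapR → AllBadGap`) and shows that for `δ > 21/20`
every particle of a `δ`-separated configuration is bad (so there the badness hypothesis is
vacuous and the item is a plain energy bound for separated matter; the range `21/20 < δ < 2`
would need sharp packing/kissing counts, not in tree).  What is NOT provable now, and is
the whole content of the item: the uniform gap for `δ ≤ 1.035` (blocks of every close packing at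
the optimal spacing `a' ≈ 0.971` are `δ`-separated there), i.e. that Lennard-Jones matter with NO
`1/20`-fcc/hcp two-shell environment is uniformly worse per particle than the periodic infimum —
a quantitative piece of the 3-D Lennard-Jones crystallization problem (BlancLewin2015 §2.3, open);
the route files it as kill criterion (i).
-/

noncomputable section

namespace Summit.AtomisticToContinuum.Crystallization.Theorems.PhononSlackCertificatesAllBadGapFloor

open scoped BigOperators Classical
open Literature.MathematicalPhysics.StatisticalMechanics Literature.Geometry.DiscreteGeometry
open Summit.AtomisticToContinuum.Crystallization.Theorems.ChargedEnergyGapNegative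
  (eStar eStar_le bddBelow_energyPerParticle_lennardJones card_mul_eStar_le_interactionEnergy)
open Summit.AtomisticToContinuum.Crystallization.Theorems.LayeredLawsSelectHcp.Negative.Threshold
  (eStar_le_neg_half)

/-! ## The `g = 0` floor -/

/-- **The `g = 0` floor `N · e* ≤ 𝓔_LJ(x)`** for every configuration of distinct points of `ℝ³`:
periodise `x` with a large cubic period (`e(periodise x) ≤ 𝓔(x)/N`, the images interacting only
through the attractive tail) and use `e* ≤ e(Q)` for every periodic `Q` (boundedness below of
periodic Lennard-Jones energies, item 0714) — the tree's
`ChargedEnergyGapNegative.card_mul_eStar_le_interactionEnergy`, made unconditional. [folklore] -/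
theorem card_mul_iInf_le_interactionEnergy {N : ℕ} {x : Fin N → (EuclideanSpace ℝ (Fin 3))} (hx : Function.Injective x) :
    (N : ℝ) * (⨅ Q : PeriodicConfiguration 3, Q.energyPerParticle lennardJones) ≤
      interactionEnergy lennardJones x :=
  card_mul_eStar_le_interactionEnergy bddBelow_energyPerParticle_lennardJones hx

/-- A `δ`-separated configuration (`δ > 0`) consists of distinct points. [folklore] -/
theorem injective_of_separated {N : ℕ} {x : Fin N → (EuclideanSpace ℝ (Fin 3))} {δ : ℝ} (hδ : 0 < δ)
    (hsep : ∀ i j : Fin N, i ≠ j → δ ≤ dist (x i) (x j)) : Function.Injective x := by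
  intro i j hij
  by_contra hne
  have h := hsep i j hne
  rw [hij, dist_self] at h
  exact absurd h (not_le.2 hδ)

/-- **`AllBadGap` at `g = 0`** (no badness needed): every `δ`-separated configuration, `δ > 0`,
has `N · e* ≤ 𝓔_LJ(x)`. [folklore] -/
theorem allBadGap_zero {δ : ℝ} (hδ : 0 < δ) (N : ℕ) (x : Fin N → (EuclideanSpace ℝ (Fin 3)))
    (hsep : ∀ i j : Fin N, i ≠ j → δ ≤ dist (x i) (x j)) :
    (N : ℝ) * (⨅ Q : PeriodicConfiguration 3, Q.energyPerParticle lennardJones) ≤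
      interactionEnergy lennardJones x :=
  card_mul_iInf_le_interactionEnergy (injective_of_separated hδ hsep)

/-! ## The dilute regime `δ ≥ 2` -/

/-- The attractive part dominates from below: `V_LJ(r) ≥ −(1/6)·r⁻⁶`. [cite: BlancLewin2015, §1.1 (3)] -/
theorem neg_inv_pow_six_le_lennardJones (r : ℝ) : -(1 / 6 * r⁻¹ ^ 6) ≤ lennardJones r := by
  unfold lennardJones
  have h : (0 : ℝ) ≤ 1 / 12 * r⁻¹ ^ 12 := by positivity
  linarith

/-- **Site energies of `δ`-separated configurations**: `∑_{k ≠ i} V_LJ(|xᵢ − x_k|) ≥ −(250/6)·δ⁻⁶`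
(drop the repulsion, shell sum `sum_inv_pow_six_le`). [folklore] -/
theorem neg_le_siteEnergy_of_separated {N : ℕ} (x : Fin N → (EuclideanSpace ℝ (Fin 3))) {δ : ℝ} (hδ : 0 < δ)
    (hsep : ∀ i j : Fin N, i ≠ j → δ ≤ dist (x i) (x j)) (i : Fin N) :
    -(250 / 6 * δ⁻¹ ^ 6) ≤ siteEnergy lennardJones x i := by
  have hS := sum_inv_pow_six_le x hδ hsep i
  unfold siteEnergy
  calc -(250 / 6 * δ⁻¹ ^ 6) ≤ -(1 / 6) * ∑ k ∈ Finset.univ.erase i, (dist (x i) (x k))⁻¹ ^ 6 := by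
        nlinarith
    _ = ∑ k ∈ Finset.univ.erase i, -(1 / 6 * (dist (x i) (x k))⁻¹ ^ 6) := by
        rw [Finset.mul_sum]
        refine Finset.sum_congr rfl fun k _ => ?_
        ring
    _ ≤ ∑ k ∈ Finset.univ.erase i, lennardJones (dist (x i) (x k)) :=
        Finset.sum_le_sum fun k _ => neg_inv_pow_six_le_lennardJones _

/-- **Energy of `δ`-separated configurations**: `𝓔_LJ(x) ≥ −N·(250/12)·δ⁻⁶`. [folklore] -/
theorem neg_le_interactionEnergy_of_separated {N : ℕ} (x : Fin N → (EuclideanSpace ℝ (Fin 3))) {δ : ℝ} (hδ : 0 < δ)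
    (hsep : ∀ i j : Fin N, i ≠ j → δ ≤ dist (x i) (x j)) :
    -((N : ℝ) * (250 / 12 * δ⁻¹ ^ 6)) ≤ interactionEnergy lennardJones x := by
  have h2 := two_mul_interactionEnergy lennardJones x
  have hsum : ∑ _i : Fin N, -(250 / 6 * δ⁻¹ ^ 6) ≤ ∑ i, siteEnergy lennardJones x i :=
    Finset.sum_le_sum fun i _ => neg_le_siteEnergy_of_separated x hδ hsep i
  rw [Finset.sum_const, Finset.card_univ, Fintype.card_fin, nsmul_eq_mul] at hsum
  linarith

/-- **The dilute regime.** For `δ ≥ 2` the conclusion of `AllBadGap` holds with the explicit gap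
`g = 1/2 − (250/12)·δ⁻⁶ ≥ 1/2 − 250/768 > 0`, for EVERY `δ`-separated configuration (bad or not):
`𝓔_LJ(x) ≥ −N·(250/12)·δ⁻⁶ = N·(−1/2 + g) ≥ N·(e* + g)` by `e* ≤ e(fcc, 1) ≤ −1/2`. [folklore] -/
theorem allBadGap_dilute {δ : ℝ} (hδ : 2 ≤ δ) :
    ∃ g : ℝ, 0 < g ∧ ∀ (N : ℕ) (x : Fin N → (EuclideanSpace ℝ (Fin 3))),
      (∀ i j : Fin N, i ≠ j → δ ≤ dist (x i) (x j)) →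
      (N : ℝ) * ((⨅ Q : PeriodicConfiguration 3, Q.energyPerParticle lennardJones) + g) ≤
        interactionEnergy lennardJones x := by
  have hδ0 : (0 : ℝ) < δ := by linarith
  have hinv : δ⁻¹ ^ 6 ≤ 1 / 64 := by
    have h1 : δ⁻¹ ≤ (2 : ℝ)⁻¹ := inv_anti₀ (by norm_num) hδ
    calc δ⁻¹ ^ 6 ≤ (2 : ℝ)⁻¹ ^ 6 := pow_le_pow_left₀ (inv_nonneg.2 hδ0.le) h1 6
      _ = 1 / 64 := by norm_num
  refine ⟨1 / 2 - 250 / 12 * δ⁻¹ ^ 6, by nlinarith, fun N x hsep => ?_⟩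
  have hE := neg_le_interactionEnergy_of_separated x hδ0 hsep
  have he : (⨅ Q : PeriodicConfiguration 3, Q.energyPerParticle lennardJones) ≤ -1 / 2 :=
    eStar_le_neg_half
  have hN : (0 : ℝ) ≤ N := Nat.cast_nonneg N
  nlinarith

/-- **`AllBadGap` restricted to `δ ≥ 2`**, in the exact shape of the route decl (the badness
hypothesis is not used in this regime). [folklore] -/
theorem allBadGap_of_two_le :
    ∀ δ : ℝ, 2 ≤ δ → ∃ g : ℝ, 0 < g ∧ ∀ (N : ℕ) (x : Fin N → EuclideanSpace ℝ (Fin 3)),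
      (∀ i j : Fin N, i ≠ j → δ ≤ dist (x i) (x j)) →
      (∀ i : Fin N, ¬ IsTwoShellGood (1 / 20) (47 / 50) 1 x i) →
      (N : ℝ) * ((⨅ Q : PeriodicConfiguration 3, Q.energyPerParticle lennardJones) + g) ≤
        interactionEnergy lennardJones x := by
  intro δ hδ
  obtain ⟨g, hg, h⟩ := allBadGap_dilute hδ
  exact ⟨g, hg, fun N x hsep _ => h N x hsep⟩

end Summit.AtomisticToContinuum.Crystallization.Theorems.PhononSlackCertificatesAllBadGapFloor

end
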